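import Mathlib
import Literature.AlgebraicGeometry.Tropical.InitialIdeal
import Literature.AlgebraicGeometry.Tropical.TropicalLink

/-!
# TropicalLinks / InductiveStep — the ray algebra of a stratum chart modulo its fibre ideal
# (roadmap brick G1)

Route `ResolutionOfSingularities/TropicalLinks`, crux `InductiveStep` (stmt-ResolutionOfSingularities-17233),
line `split`, in support of stub `stub_sncClosureSchon`.

Informal statement.  For a Luxton–Qu stratum chart — a `k`-algebra `A = 𝒪(Star S)` embedded in the
coordinate ring `𝒪 = 𝒪(U°) = k[ℤ × K] ⧸ J` of the very affine variety, generated by the torus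
monomials it contains, with boundary equations `m : Fin l → A` (so that `𝒪 = A[1/∏ m]` and every torus
monomial `x^w` is a unit of `A` times the `m`-monomial of exponent `a w`) and weights `b` of the ray
(`w.1 = ⟨b, a w⟩`) — the closure of `U°` in the partial compactification along the ray is `Spec` of the
ray algebra `S = A[m^c : ⟨b, c⟩ ≥ 0] ⊆ A[1/∏ m]`, and its fibre ideal `Jb = (m^c : ⟨b, c⟩ > 0)` is
`(x₁)`:

* `tropicalLinks_nonempty_rayAlgebra_quotient_ringEquiv_range_quotient` (registered brick G1) —
  `S ⧸ Jb ≃+* B ⧸ (x₁)`, where `B ⊆ 𝒪` is the image of `k[ℕ × K] = k[x₁, y^±]`.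

Proof sketch.  The universal property of the localisation gives `f : A[1/∏ m] →+* 𝒪` extending the
embedding `ιA` (the `ιA (m i)` are units of `𝒪` because a torus monomial is); `f` is injective.  The
monomial identities `x^w = ιA ε · f (m^(a w))` show `f(S) = B` (generators go to generators: `A` is
generated by the monomials `x^w` with `a w ≥ 0`, whence `w.1 ≥ 0`; and `f (m^c) = (ιA ε)⁻¹ x^w` with
`a w = c`, `w.1 = ⟨b, c⟩ ≥ 0`), so `f` restricts to a ring isomorphism `S ≃+* B`; and the same identities
show that it carries the generators `m^c`, `⟨b, c⟩ > 0`, of `Jb` to unit multiples of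
`x^w = x^(w - e₁) · x₁ ∈ (x₁)`, while `x₁ = ιA ε · f (m^(a e₁))` with `⟨b, a e₁⟩ = 1 > 0`.  Conclude with
`Ideal.quotientEquiv`.  No new definitions.
-/

set_option linter.dupNamespace false -- single-conjunct summit: doubled namespace component is mandated

namespace Summit.ResolutionOfSingularities.ResolutionOfSingularities.Theorems

open AddMonoidAlgebra

section StratumChart

/-- Units bookkeeping: if `X · ∏ uᵢ^{(-cᵢ)⁺} = E · ∏ uᵢ^{cᵢ⁺}` for units `uᵢ` of a commutative ring,
then `X = E · ∏ uᵢ^{cᵢ}`. [folklore] -/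
theorem tropicalLinks_eq_mul_units_prod_zpow {O : Type} [CommRing O] {ι : Type} [Fintype ι]
    (u : ι → Oˣ) (c : ι → ℤ) {X E : O}
    (h : X * ∏ i, (u i : O) ^ (-(c i)).toNat = E * ∏ i, (u i : O) ^ (c i).toNat) :
    X = E * ((∏ i, u i ^ c i : Oˣ) : O) := by
  have hP : ((∏ i, u i ^ ((c i).toNat : ℤ) : Oˣ) : O) = ∏ i, (u i : O) ^ (c i).toNat := by
    rw [Units.coe_prod]
    refine Finset.prod_congr rfl fun i _ => ?_
    rw [zpow_natCast, Units.val_pow_eq_pow_val]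
  have hN : ((∏ i, u i ^ ((-(c i)).toNat : ℤ) : Oˣ) : O) = ∏ i, (u i : O) ^ (-(c i)).toNat := by
    rw [Units.coe_prod]
    refine Finset.prod_congr rfl fun i _ => ?_
    rw [zpow_natCast, Units.val_pow_eq_pow_val]
  have hsplit : (∏ i, u i ^ c i : Oˣ) =
      (∏ i, u i ^ ((c i).toNat : ℤ)) * (∏ i, u i ^ ((-(c i)).toNat : ℤ))⁻¹ := by
    rw [← Finset.prod_inv_distrib, ← Finset.prod_mul_distrib]
    refine Finset.prod_congr rfl fun i _ => ?_
    rw [← zpow_neg, ← zpow_add, ← sub_eq_add_neg, Int.toNat_sub_toNat_neg]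
  rw [hsplit, Units.val_mul, ← mul_assoc, Units.eq_mul_inv_iff_mul_eq, hN, hP]
  exact h

variable {k : Type} [CommRing k] {K : Type} [AddCommGroup K]

/-- A torus monomial `x^w` with `w.1 ≥ 0` lies in the image `B` of `k[ℕ × K] = k[x₁, y^±]` in
`k[ℤ × K] ⧸ J`. [folklore] -/
theorem tropicalLinks_mk_single_mem_range_of_fst_nonneg (J : Ideal (AddMonoidAlgebra k (ℤ × K)))
    {w : ℤ × K} (hw : 0 ≤ w.1) :
    Ideal.Quotient.mk J (single w (1 : k)) ∈
      ((Ideal.Quotient.mkₐ k J).comp (AddMonoidAlgebra.mapDomainAlgHom k k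
        ((Nat.castAddMonoidHom ℤ).prodMap (AddMonoidHom.id K)))).range := by
  rw [AlgHom.mem_range]
  refine ⟨single (w.1.toNat, w.2) 1, ?_⟩
  rw [AlgHom.comp_apply, mapDomainAlgHom_apply, mapDomain_single, Ideal.Quotient.mkₐ_eq_mk,
    AddMonoidHom.coe_prodMap, Prod.map_apply, Nat.coe_castAddMonoidHom, Int.toNat_of_nonneg hw,
    AddMonoidHom.id_apply]

/-- The image `B` of `k[ℕ × K]` in `k[ℤ × K] ⧸ J` is generated, as a `k`-module, by the torus monomials
`x^(n, κ)`, `n : ℕ`: any subring containing the scalars and these monomials contains `B`. [folklore] -/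
theorem tropicalLinks_mkₐ_comp_mapDomain_mem_of_forall_single (J : Ideal (AddMonoidAlgebra k (ℤ × K)))
    (T : Subring (AddMonoidAlgebra k (ℤ × K) ⧸ J))
    (hT₀ : ∀ r : k, algebraMap k (AddMonoidAlgebra k (ℤ × K) ⧸ J) r ∈ T)
    (hT : ∀ (n : ℕ) (κ : K), Ideal.Quotient.mk J (single (((n : ℤ), κ) : ℤ × K) (1 : k)) ∈ T)
    (p : AddMonoidAlgebra k (ℕ × K)) :
    ((Ideal.Quotient.mkₐ k J).comp (AddMonoidAlgebra.mapDomainAlgHom k k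
        ((Nat.castAddMonoidHom ℤ).prodMap (AddMonoidHom.id K)))) p ∈ T := by
  induction p using AddMonoidAlgebra.induction_on with
  | hM w =>
    obtain ⟨n, κ⟩ := w
    rw [AddMonoidAlgebra.of_apply, toAdd_ofAdd, AlgHom.comp_apply, mapDomainAlgHom_apply,
      mapDomain_single, Ideal.Quotient.mkₐ_eq_mk, AddMonoidHom.coe_prodMap, Prod.map_apply,
      Nat.coe_castAddMonoidHom, AddMonoidHom.id_apply]
    exact hT n κ
  | hadd p q hp hq =>
    rw [map_add]
    exact add_mem hp hq
  | hsmul r p hp =>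
    rw [show r • p = algebraMap k _ r * p from Algebra.smul_def r p, map_mul, AlgHom.commutes]
    exact mul_mem (hT₀ r) hp

end StratumChart

/-- **The ray algebra of a stratum chart modulo its fibre ideal is the image of the partial
compactification modulo `x₁`** (registered brick G1).  For a field `k`, an ideal `J ⊆ k[ℤ × K]` with
`𝒪 := k[ℤ × K] ⧸ J`, a `k`-algebra `A` with an injective `k`-algebra map `ιA : A → 𝒪` such that
`𝒪 = A[1/∏ m]`, the ray `fst = ⟨b, a(·)⟩`, every torus monomial a unit of `A` times the `m`-monomial of
exponent `a w`, and `A` generated by the monomials it contains, the ray algebra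
`S = A[∏ vᵢ^cᵢ : ⟨b, c⟩ ≥ 0] ⊆ A[1/∏ m]` modulo its fibre ideal `Jb = (∏ vᵢ^cᵢ : ⟨b, c⟩ > 0)` is
ring-isomorphic to `B ⧸ (x₁)`, `B` the image of `k[ℕ × K]` in `𝒪`. [folklore] -/
theorem tropicalLinks_nonempty_rayAlgebra_quotient_ringEquiv_range_quotient :
    ∀ (k : Type) [Field k] (K : Type) [AddCommGroup K] (J : Ideal (AddMonoidAlgebra k (ℤ × K))) (A : Type) [CommRing A] [Algebra k A] (ιA : A →ₐ[k] AddMonoidAlgebra k (ℤ × K) ⧸ J) (l : ℕ) (m : Fin l → A) (b : Fin l → ℕ) (a : (ℤ × K) →+ (Fin l → ℤ)), Function.Injective ιA → (∀ y : AddMonoidAlgebra k (ℤ × K) ⧸ J, ∃ (x : A) (n : ℕ), y * ιA (∏ i, m i) ^ n = ιA x) → Function.Surjective a → (∀ w : ℤ × K, w.1 = ∑ i, (b i : ℤ) * a w i) → (∀ w : ℤ × K, ∃ ε : Aˣ, Ideal.Quotient.mk J (AddMonoidAlgebra.single w (1 : k)) * ιA (∏ i, m i ^ (-(a w i)).toNat)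 = ιA ((ε : A) * ∏ i, m i ^ (a w i).toNat)) → ιA.range = Algebra.adjoin k {x : AddMonoidAlgebra k (ℤ × K) ⧸ J | ∃ w : ℤ × K, (∀ i, 0 ≤ a w i) ∧ x = Ideal.Quotient.mk J (AddMonoidAlgebra.single w (1 : k))} → ∀ (v : Fin l → (Localization.Away (∏ i, m i))ˣ), (∀ i, (v i : Localization.Away (∏ i, m i)) = algebraMap A (Localization.Away (∏ i, m i)) (m i)) → ∀ (S : Subalgebra A (Localization.Away (∏ i, m i))), S = Algebra.adjoin A {x : Localization.Away (∏ i, m i) | ∃ c : Fin l → ℤ, 0 ≤ ∑ i, (b i : ℤ) * c i ∧ x = ((∏ i, v i ^ c i : (Localization.Away (∏ i, m i))ˣ) : Localization.Away (∏ i, m i))} → ∀ (Jb : Ideal ↥S), Jb = Ideal.span {x : ↥S | ∃ c : Fin l → ℤ, 0 < ∑ i, (b i : ℤ) * c i ∧ (x : Localization.Away (∏ i, m i)) = ((∏ i, v i ^ c i : (Localization.Away (∏ i, m i))ˣ) : Localization.Away (∏ i, m i))} → ∀ (B : Subalgebra k (AddMonoidAlgebra k (ℤ × K) ⧸ J)),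 B = ((Ideal.Quotient.mkₐ k J).comp (AddMonoidAlgebra.mapDomainAlgHom k k ((Nat.castAddMonoidHom ℤ).prodMap (AddMonoidHom.id K)))).range → Nonempty ((↥S ⧸ Jb) ≃+* (↥B ⧸ Ideal.span {x : ↥B | (x : AddMonoidAlgebra k (ℤ × K) ⧸ J) = Ideal.Quotient.mk J (AddMonoidAlgebra.single ((1 : ℤ), (0 : K)) (1 : k))})) := by
  intro k _ K _ J A _ _ ιA l m b a hinj _hloc ha hρ hmon hgen v hv S hS Jb hJb B hB
  classical
  set O := AddMonoidAlgebra k (ℤ × K) ⧸ J with hO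
  set L := Localization.Away (∏ i, m i) with hL
  -- Step 0: `ιA (∏ m)` is a unit of `𝒪` (a torus monomial is `ε · (∏ m)⁻¹` for `a w = -1`)
  have hunit : IsUnit (ιA (∏ i, m i)) := by
    obtain ⟨w, hw⟩ := ha (fun _ => -1)
    obtain ⟨ε, hε⟩ := hmon w
    have h1 : ∏ i, m i ^ (-(a w i)).toNat = ∏ i, m i :=
      Finset.prod_congr rfl fun i _ => by simp [hw]
    have h2 : ∏ i, m i ^ (a w i).toNat = 1 := Finset.prod_eq_one fun i _ => by simp [hw]
    rw [h1, h2, mul_one] at hε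
    exact isUnit_of_mul_isUnit_right (hε ▸ ε.isUnit.map ιA)
  -- the extension `f : A[1/∏ m] → 𝒪` of `ιA`; it is injective
  let f : L →+* O := IsLocalization.Away.lift (∏ i, m i) (g := (ιA : A →+* O)) hunit
  have hf : ∀ x : A, f (algebraMap A L x) = ιA x := fun x => IsLocalization.Away.lift_eq _ hunit x
  have hfinj : Function.Injective f := by
    rw [injective_iff_map_eq_zero]
    intro z hz
    obtain ⟨n, x, hx⟩ := IsLocalization.Away.surj (∏ i, m i) z
    have h0 : ιA x = 0 := by rw [← hf, ← hx, map_mul, hz, zero_mul]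
    rw [map_eq_zero_iff _ hinj] at h0
    rw [h0, map_zero] at hx
    exact (IsLocalization.Away.algebraMap_pow_isUnit (∏ i, m i) n).mul_left_eq_zero.1 hx
  clear_value f
  -- the units `uᵢ = f (vᵢ) = ιA (mᵢ)` of `𝒪` and the images of the `v`-monomials
  obtain ⟨u, hu, hfmon⟩ : ∃ u : Fin l → Oˣ, (∀ i, (u i : O) = ιA (m i)) ∧
      ∀ c : Fin l → ℤ, f ((∏ i, v i ^ c i : Lˣ) : L) = ((∏ i, u i ^ c i : Oˣ) : O) := by
    refine ⟨fun i => Units.map (f : L →* O) (v i), fun i => ?_, fun c => ?_⟩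
    · rw [Units.coe_map, MonoidHom.coe_coe, hv, hf]
    · rw [← MonoidHom.coe_coe f, ← Units.coe_map, map_prod]
      simp_rw [map_zpow]
  -- every torus monomial is `ιA ε · u^(a w)`
  have hxw : ∀ w : ℤ × K, ∃ ε : Aˣ,
      Ideal.Quotient.mk J (single w (1 : k)) = ιA ε * ((∏ i, u i ^ a w i : Oˣ) : O) := by
    intro w
    obtain ⟨ε, hε⟩ := hmon w
    refine ⟨ε, tropicalLinks_eq_mul_units_prod_zpow u (a w) ?_⟩
    simpa only [map_mul, map_prod, map_pow, ← hu] using hε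
  -- membership in `S`
  have hmonS : ∀ c : Fin l → ℤ, 0 ≤ ∑ i, (b i : ℤ) * c i → ((∏ i, v i ^ c i : Lˣ) : L) ∈ S := by
    intro c hc
    rw [hS]
    exact Algebra.subset_adjoin ⟨c, hc, rfl⟩
  have hAS : ∀ x : A, algebraMap A L x ∈ S := fun x => S.algebraMap_mem x
  -- membership in `B`
  have hxB : ∀ w : ℤ × K, 0 ≤ w.1 → Ideal.Quotient.mk J (single w (1 : k)) ∈ B := by
    intro w hw
    rw [hB]
    exact tropicalLinks_mk_single_mem_range_of_fst_nonneg J hw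
  have hιB : ∀ x : A, ιA x ∈ B := by
    intro x
    have hx : ιA x ∈ ιA.range := ⟨x, rfl⟩
    rw [hgen] at hx
    refine (Algebra.adjoin_le ?_ : Algebra.adjoin k _ ≤ B) hx
    rintro _ ⟨w, hw, rfl⟩
    refine hxB w ?_
    rw [hρ w]
    exact Finset.sum_nonneg fun i _ => mul_nonneg (Int.natCast_nonneg _) (hw i)
  -- `f (S) ⊆ B`
  have hfSB : ∀ x ∈ S, f x ∈ B := by
    intro x hx
    rw [hS] at hx
    induction hx using Algebra.adjoin_induction with
    | mem x hx =>
      obtain ⟨c, hc, rfl⟩ := hx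
      obtain ⟨w, hw⟩ := ha c
      obtain ⟨ε, hε⟩ := hxw w
      have key : ((∏ i, u i ^ a w i : Oˣ) : O) = ιA (↑ε⁻¹ : A) * Ideal.Quotient.mk J (single w 1) := by
        rw [hε, ← mul_assoc, ← map_mul, Units.inv_mul, map_one, one_mul]
      rw [hfmon, ← hw, key]
      refine mul_mem (hιB _) (hxB w ?_)
      rw [hρ w, hw]
      exact hc
    | algebraMap r =>
      rw [hf]
      exact hιB r
    | add x y _ _ hx hy =>
      rw [map_add]
      exact add_mem hx hy
    | mul x y _ _ hx hy =>
      rw [map_mul]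
      exact mul_mem hx hy
  -- `B ⊆ f (S)`
  have hsurjB : ∀ y ∈ B, ∃ x ∈ S, f x = y := by
    intro y hy
    rw [hB, AlgHom.mem_range] at hy
    obtain ⟨p, rfl⟩ := hy
    have key := tropicalLinks_mkₐ_comp_mapDomain_mem_of_forall_single J (S.toSubring.map f)
      (fun r => ?_) (fun n κ => ?_) p
    · obtain ⟨x, hx, hfx⟩ := Subring.mem_map.1 key
      exact ⟨x, Subalgebra.mem_toSubring.1 hx, hfx⟩
    · refine Subring.mem_map.2 ⟨algebraMap A L (algebraMap k A r),
        Subalgebra.mem_toSubring.2 (hAS _), ?_⟩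
      rw [hf, AlgHom.commutes]
    · obtain ⟨ε, hε⟩ := hxw ((n : ℤ), κ)
      refine Subring.mem_map.2
        ⟨algebraMap A L (ε : A) * ((∏ i, v i ^ a ((n : ℤ), κ) i : Lˣ) : L), ?_, ?_⟩
      · refine Subalgebra.mem_toSubring.2 (mul_mem (hAS _) (hmonS _ ?_))
        rw [← hρ]
        exact Int.natCast_nonneg n
      · rw [map_mul, hf, hfmon, hε]
  -- the ring isomorphism `e : S ≃+* B` induced by `f`
  let g : ↥S →+* ↥B := (f.comp (SubringClass.subtype S)).codRestrict B fun x => hfSB x.1 x.2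
  have hg : ∀ x : ↥S, ((g x : ↥B) : O) = f x := fun x => rfl
  have hginj : Function.Injective g := by
    intro x y hxy
    apply Subtype.ext
    apply hfinj
    rw [← hg, ← hg, hxy]
  have hgsurj : Function.Surjective g := by
    intro y
    obtain ⟨x, hx, hfx⟩ := hsurjB y.1 y.2
    exact ⟨⟨x, hx⟩, Subtype.ext (by rw [hg]; exact hfx)⟩
  let e : ↥S ≃+* ↥B := RingEquiv.ofBijective g ⟨hginj, hgsurj⟩
  have he : ∀ x : ↥S, ((e x : ↥B) : O) = f x := fun x => rfl
  clear_value e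
  -- the fibre ideal goes to `(x₁)`
  set x₁ : O := Ideal.Quotient.mk J (single (((1 : ℤ), (0 : K)) : ℤ × K) (1 : k)) with hx₁
  have hx₁B : x₁ ∈ B := hxB ((1 : ℤ), (0 : K)) zero_le_one
  have hideal : Ideal.span {x : ↥B | (x : O) = x₁} = Jb.map (e : ↥S →+* ↥B) := by
    rw [hJb, Ideal.map_span]
    apply le_antisymm
    · rw [Ideal.span_le]
      intro X hX
      obtain ⟨ε, hε⟩ := hxw ((1 : ℤ), (0 : K))
      have hpos : 0 < ∑ i, (b i : ℤ) * a ((1 : ℤ), (0 : K)) i := by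
        rw [← hρ]
        exact zero_lt_one
      have hsS : (⟨_, hmonS _ hpos.le⟩ : ↥S) ∈ {x : ↥S | ∃ c : Fin l → ℤ, 0 < ∑ i, (b i : ℤ) * c i ∧
          (x : L) = ((∏ i, v i ^ c i : Lˣ) : L)} := ⟨_, hpos, rfl⟩
      have hX' : X = e ⟨algebraMap A L (ε : A), hAS _⟩ * e ⟨_, hmonS _ hpos.le⟩ := by
        apply Subtype.ext
        rw [MulMemClass.coe_mul, he, he, hf, hfmon, ← hε]
        exact hX
      rw [hX']
      exact Ideal.mul_mem_left _ _ (Ideal.subset_span ⟨_, hsS, rfl⟩)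
    · rw [Ideal.span_le]
      rintro _ ⟨x, ⟨c, hc, hxc⟩, rfl⟩
      obtain ⟨w, hw⟩ := ha c
      obtain ⟨ε, hε⟩ := hxw w
      have hw1 : 0 ≤ (w - ((1 : ℤ), (0 : K))).1 := by
        rw [Prod.fst_sub, hρ w, hw]
        linarith
      have hsplit : Ideal.Quotient.mk J (single w (1 : k)) =
          Ideal.Quotient.mk J (single (w - ((1 : ℤ), (0 : K))) 1) * x₁ := by
        rw [hx₁, ← map_mul, single_mul_single, sub_add_cancel, mul_one]
      have hex : (e x : ↥B) =
          ⟨ιA (↑ε⁻¹ : A) * Ideal.Quotient.mk J (single (w - ((1 : ℤ), (0 : K))) (1 : k)),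
            mul_mem (hιB _) (hxB _ hw1)⟩ * ⟨x₁, hx₁B⟩ := by
        apply Subtype.ext
        rw [MulMemClass.coe_mul, he, hxc, hfmon, ← hw]
        show _ = ιA (↑ε⁻¹ : A) * Ideal.Quotient.mk J (single (w - ((1 : ℤ), (0 : K))) (1 : k)) * x₁
        rw [mul_assoc, ← hsplit, hε, ← mul_assoc, ← map_mul, Units.inv_mul, map_one, one_mul]
      show e x ∈ Ideal.span {x : ↥B | (x : O) = x₁}
      rw [hex]
      exact Ideal.mul_mem_left _ _ (Ideal.subset_span rfl)
  exact ⟨Ideal.quotientEquiv Jb _ e hideal⟩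

end Summit.ResolutionOfSingularities.ResolutionOfSingularities.Theorems
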